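import Mathlib.Order.PiLex
import Mathlib.Data.Prod.Lex
import Mathlib.Order.WellFoundedSet
import Mathlib.Order.OrderIsoNat
import Mathlib.Order.WithBot
import HarnessLib

/-!
# Kawanoue–Matsuki (2016): termination of the Idealistic Filtration Program's Step 1 —
the order-theoretic skeleton of "weaving the strand `inv_new`", kernel-checked

`Literature/AlgebraicGeometry/KawanoueMatsuki2016/WeavingTermination.lean` (repair cell
`pub-hironaka`, unit `b2b-hironaka-cp4` gen 6; companion of OBSTRUCTIONS-DIM4.md §14 row **O10** and
§17). H. Kawanoue, K. Matsuki, *Resolution of singularities of an idealistic filtration in dimension 3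
after Benito–Villamayor*, Adv. Stud. Pure Math. **70** (2016) 115–214 = arXiv:1205.4556 (bib
`KawanoueMatsuki2016`), §4.3 "Weaving of the new strand of invariants `inv_new`" (arXiv chunks
p0023–p0027 of the held text).

**What is printed.** In year `i` of the resolution sequence one weaves a finite strand of units
`(inv_new)_i = (σ_i^0, μ̃_i^0, s_i^0)(σ_i^1, μ̃_i^1, s_i^1) ⋯ (σ_i^m, μ̃_i^m, s_i^m)`, compared
lexicographically (units lexicographically, `σ` in a value set with the descending chain condition,
`μ̃ ∈ ℚ_{≥0} ∪ {∞}`, `s ∈ ℤ_{≥0}`); "Termination in the horizontal direction … going from the `j`-th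
unit to the `(j+1)`-th unit we have `(σ_i^j, #E_i^j) > (σ_i^{j+1}, #E_i^{j+1})`"; "Termination in the
vertical direction: Since the value of the strand `inv_new` never increases after each transformation
… in some year `i'`, the value of the strand strictly decreases"; "suppose by induction … the value of
`(inv_new)^{≤ t−1}` can not decrease infinitely many times … after some year the value of
`(inv_new)^{≤ t−1}(σ^t)` stabilizes … This implies that the denominator of the invariant `μ̃` is
bounded, and hence that the invariant `μ̃` can not decrease infinitely many times"; "We claim that we
have either `σ_t > σ_{t+1}` or `σ_t = σ_{t+1} > σ_{t+2}`" (proved on p0026–p0027 from the behaviour of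
young/aged boundary divisors and the transversality of an aged divisor to the leading generator
system); "Since the value of the invariant `σ` satisfies the descending chain condition, the increase
of the value of `t` stops after finitely many times. … Therefore, the algorithm terminates after
finitely many years." [cite: KawanoueMatsuki2016, §4.3]

**What is kernel-checked here (bookkeeping only; every analytic input is a named hypothesis).** A run
is an infinite sequence of strands `inv i : ℕ → WithBot (IFPUnit S M)` (`⊥` = "no unit at this
stage"; `IFPUnit S M = S ×ₗ (M ×ₗ ℕ)` with the lexicographic order; strands compared in `Pi.Lex`, which
on well-formed strands is the printed lexicographic comparison). `IFPRun` packages the printed inputs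
as hypotheses: `wellFormed` (no unit after a missing unit), `nonIncreasing` ("never increases"),
`boundedDenominators` (once the prefix `≤ t−1` and `σ^t` are stable, the `μ̃^t` range in a well-ordered
set), `horizontal` (`σ^j ≥ σ^{j+1}` inside a strand) and `twoStepDrop` (the claim
`σ_t > σ_{t+1} ∨ σ_t = σ_{t+1} > σ_{t+2}`, stated in the stable regime of the prefix `≤ t+2`, where
the paper's `σ_t = σ^t_{i_t}` are the values of the strand). THEOREMS: `IFPRun.prefix_stable` (every
prefix `(inv_new)^{≤ t−1}` is eventually constant — the printed induction on `t`),
`IFPRun.eventually_constant` (the whole strand is eventually constant: the printed two-step `σ`-drop is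
exactly what excludes strands of unbounded length, the one way a lexicographic order on finite
sequences over a well-order fails to be well-founded), and `IFPRun.no_infinite_run` (adding the printed
"in some year `i'` the value strictly decreases" is contradictory for an infinite run: the algorithm
stops). No dimension enters: the only dimension-dependent input of [KM16] §4 is the disjunct of
"strictly decreases" coming from the MONOMIAL CASE (`(σ^m, 0, 0)`, [KM16] §4.2 (5), §5: `dim W ≤ 3`),
which is census row O10 (`IFPMonomialCase(d)`) — here it is inside the hypothesis `strictDecrease` of
`no_infinite_run`, not inside the bookkeeping. Sharpness (section `Sharpness`): the explicit run
`growingRun` satisfies the four other hypotheses, strictly decreases every year, and does not stabilize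
(`growingRun_hypotheses`, `growingRun_lt`, `growingRun_not_eventually_constant`) — the two-step `σ`-drop
is the hypothesis that cannot be omitted. [cite: KawanoueMatsuki2016, §4.2, §4.3]
-/

namespace Literature.AlgebraicGeometry.KawanoueMatsuki2016

/-- A unit `(σ, μ̃, s)` of the strand `inv_new` ([KM16] §4.3), ordered lexicographically: `σ ∈ S`
(a linear order with DCC in the application), `μ̃ ∈ M` (there `ℚ_{≥0} ∪ {∞}`), `s ∈ ℕ`.
[cite: KawanoueMatsuki2016, §4.3] -/
abbrev IFPUnit (S M : Type*) := S ×ₗ (M ×ₗ ℕ)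

namespace IFPUnit

variable {S M : Type*}

/-- The invariant `σ` of a unit. [cite: KawanoueMatsuki2016, §4.3] -/
def σ (u : IFPUnit S M) : S := (ofLex u).1
/-- The invariant `μ̃` of a unit. [cite: KawanoueMatsuki2016, §4.3] -/
def μ (u : IFPUnit S M) : M := (ofLex (ofLex u).2).1
/-- The invariant `s` (number of aged boundary components) of a unit. [cite: KawanoueMatsuki2016, §4.3] -/
def s (u : IFPUnit S M) : ℕ := (ofLex (ofLex u).2).2

/-- Two units with the same three invariants are equal. [folklore] -/
theorem ext {u v : IFPUnit S M} (h₁ : u.σ = v.σ) (h₂ : u.μ = v.μ) (h₃ : u.s = v.s) : u = v := by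
  unfold σ at h₁; unfold μ at h₂; unfold s at h₃
  apply ofLex.injective
  apply Prod.ext h₁
  apply ofLex.injective
  exact Prod.ext h₂ h₃

variable [LinearOrder S] [LinearOrder M]

/-- Lexicographic comparison, first component. [folklore] -/
theorem σ_le_of_le {u v : IFPUnit S M} (h : u ≤ v) : u.σ ≤ v.σ :=
  Prod.Lex.monotone_fst u v h

/-- Lexicographic comparison, second component when the first ties. [folklore] -/
theorem μ_le_of_le {u v : IFPUnit S M} (h : u ≤ v) (hσ : u.σ = v.σ) : u.μ ≤ v.μ := by
  rcases Prod.Lex.le_iff.mp h with h' | ⟨-, h'⟩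
  · exact absurd hσ (ne_of_lt h')
  · exact Prod.Lex.monotone_fst _ _ h'

/-- Lexicographic comparison, third component when the first two tie. [folklore] -/
theorem s_le_of_le {u v : IFPUnit S M} (h : u ≤ v) (hσ : u.σ = v.σ) (hμ : u.μ = v.μ) :
    u.s ≤ v.s := by
  rcases Prod.Lex.le_iff.mp h with h' | ⟨-, h'⟩
  · exact absurd hσ (ne_of_lt h')
  · rcases Prod.Lex.le_iff.mp h' with h'' | ⟨-, h''⟩
    · exact absurd hμ (ne_of_lt h'')
    · exact h''

end IFPUnit

/-- A strand: stage `j ↦` the `j`-th unit, `⊥` when the weaving has stopped before stage `j`.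
[cite: KawanoueMatsuki2016, §4.3] -/
abbrev Strand (S M : Type*) := ℕ → WithBot (IFPUnit S M)

/-- **A run of the IFP Step-1 algorithm, as bookkeeping** ([KM16] §4.2–§4.3): the strands
`inv i` of the years `i = 0, 1, 2, …` together with the printed facts used by "Termination in the
vertical direction", each as a hypothesis (analytic content of the paper, not proved here):
* `wellFormed` — a strand is a finite sequence: no unit after a missing unit;
* `nonIncreasing` — "the value of the strand `inv_new` never increases after each transformation"
  (lexicographic order);
* `boundedDenominators` — "after some year … the value of `(inv_new)^{≤t−1}(σ^t)` stabilizes … This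
  implies that the denominator of the invariant `μ̃` is bounded, and hence that `μ̃` can not decrease
  infinitely many times": once the units `< t` and `σ^t` are constant from year `i₀` on, the values
  `μ̃^t_i`, `i ≥ i₀`, lie in a well-ordered subset of `M`;
* `horizontal` — "going from the `j`-th unit to the `(j+1)`-th unit we have
  `(σ^j, #E^j) > (σ^{j+1}, #E^{j+1})`", whence `σ^{j+1} ≤ σ^j`;
* `twoStepDrop` — "We claim that we have either `σ_t > σ_{t+1}` or `σ_t = σ_{t+1} > σ_{t+2}`", for
  the stabilized values; stated at any year `i` from which on the units `≤ t+2` no longer change.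
[cite: KawanoueMatsuki2016, §4.3] -/
structure IFPRun (S M : Type*) [LinearOrder S] [LinearOrder M] where
  /-- the strand `(inv_new)_i` woven in year `i` -/
  inv : ℕ → Strand S M
  wellFormed : ∀ i j, inv i j = ⊥ → inv i (j + 1) = ⊥
  nonIncreasing : ∀ i, toLex (inv (i + 1)) ≤ toLex (inv i)
  boundedDenominators : ∀ t i₀, (∀ i, i₀ ≤ i → (∀ j, j < t → inv i j = inv i₀ j) ∧
      (inv i t).map IFPUnit.σ = (inv i₀ t).map IFPUnit.σ) →
    ∃ W : Set M, W.IsWF ∧ ∀ i, i₀ ≤ i → ∀ u : IFPUnit S M, inv i t = ↑u → u.μ ∈ W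
  horizontal : ∀ i j (u v : IFPUnit S M), inv i j = ↑u → inv i (j + 1) = ↑v → v.σ ≤ u.σ
  twoStepDrop : ∀ t i, (∀ i', i ≤ i' → ∀ j, j ≤ t + 2 → inv i' j = inv i j) →
    ∀ u₀ u₁ u₂ : IFPUnit S M, inv i t = ↑u₀ → inv i (t + 1) = ↑u₁ → inv i (t + 2) = ↑u₂ →
      u₁.σ < u₀.σ ∨ (u₁.σ = u₀.σ ∧ u₂.σ < u₁.σ)

/-- A sequence that is non-increasing from `n₀` on and takes its values (from `n₀` on) in a
well-ordered set is eventually constant. [folklore] -/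
theorem eventually_const_of_antitone {α : Type*} [PartialOrder α] (f : ℕ → α) (n₀ : ℕ)
    (W : Set α) (hW : W.IsWF) (hstep : ∀ n, n₀ ≤ n → f (n + 1) ≤ f n)
    (hmem : ∀ n, n₀ ≤ n → f n ∈ W) : ∃ n₁, n₀ ≤ n₁ ∧ ∀ n, n₁ ≤ n → f n = f n₁ := by
  have hchain : ∀ m n, n₀ ≤ m → m ≤ n → f n ≤ f m := by
    intro m n hm hmn
    induction n, hmn using Nat.le_induction with
    | base => exact le_rfl
    | succ n hmn ih => exact (hstep n (le_trans hm hmn)).trans ih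
  -- the tail as a sequence indexed from `0`
  let g : ℕ → α := fun k => f (n₀ + k)
  have hTW : Set.range g ⊆ W := by
    rintro _ ⟨k, rfl⟩; exact hmem (n₀ + k) (Nat.le_add_right _ _)
  have hTwf : (Set.range g).IsWF := hW.mono hTW
  have hTne : (Set.range g).Nonempty := ⟨g 0, 0, rfl⟩
  obtain ⟨k₁, hk₁⟩ : ∃ k₁, g k₁ = hTwf.min hTne := hTwf.min_mem hTne
  refine ⟨n₀ + k₁, Nat.le_add_right _ _, fun n hn => ?_⟩
  have hle : f n ≤ f (n₀ + k₁) := hchain (n₀ + k₁) n (Nat.le_add_right _ _) hn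
  have hnlt : ¬f n < f (n₀ + k₁) := by
    have hn' : f n = g (n - n₀) := by simp only [g]; congr 1; omega
    rw [hn', show f (n₀ + k₁) = g k₁ from rfl, hk₁]
    exact hTwf.not_lt_min hTne ⟨n - n₀, rfl⟩
  exact hle.lt_or_eq.resolve_left hnlt

/-- Two tails on which a sequence is constant carry the same value. [folklore] -/
theorem tail_value_unique {α : Type*} (f : ℕ → α) {p q : ℕ} (hp : ∀ n, p ≤ n → f n = f p)
    (hq : ∀ n, q ≤ n → f n = f q) : f p = f q := by
  rw [← hp (max p q) (le_max_left _ _), hq (max p q) (le_max_right _ _)]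

namespace IFPRun

variable {S M : Type*} [LinearOrder S] [LinearOrder M] (R : IFPRun S M)

/-- No unit after a missing unit, iterated. [folklore] -/
theorem eq_bot_of_le {i j k : ℕ} (h : R.inv i j = ⊥) (hjk : j ≤ k) : R.inv i k = ⊥ := by
  induction k, hjk using Nat.le_induction with
  | base => exact h
  | succ k _ ih => exact R.wellFormed i k ih

/-- Prefix monotonicity of the lexicographic order: if the units `< t` did not change from year `i`
to year `i+1`, the `t`-th unit did not increase. [folklore] -/
theorem apply_le_of_prefix_eq (i t : ℕ) (h : ∀ j, j < t → R.inv (i + 1) j = R.inv i j) :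
    R.inv (i + 1) t ≤ R.inv i t :=
  Pi.apply_le_of_toLex (R.nonIncreasing i) h

variable [WellFoundedLT S]

/-- **The printed induction on `t`**: every prefix `(inv_new)^{≤ t−1}` of the strand is constant
from some year on ("can not decrease infinitely many times" + "never increases").
[cite: KawanoueMatsuki2016, §4.3] -/
theorem prefix_stable (t : ℕ) : ∃ i₀, ∀ i, i₀ ≤ i → ∀ j, j < t → R.inv i j = R.inv i₀ j := by
  induction t with
  | zero => exact ⟨0, fun i _ j hj => absurd hj (Nat.not_lt_zero j)⟩
  | succ t ih =>
    obtain ⟨i₀, h₀⟩ := ih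
    -- the `t`-th unit is non-increasing from year `i₀` on
    have hanti : ∀ i, i₀ ≤ i → R.inv (i + 1) t ≤ R.inv i t := fun i hi =>
      R.apply_le_of_prefix_eq i t fun j hj => by rw [h₀ (i + 1) (by omega) j hj, h₀ i hi j hj]
    have hchain : ∀ m n, i₀ ≤ m → m ≤ n → R.inv n t ≤ R.inv m t := by
      intro m n hm hmn
      induction n, hmn using Nat.le_induction with
      | base => exact le_rfl
      | succ n hmn ih => exact (hanti n (le_trans hm hmn)).trans ih
    -- conclusion template: stability of the prefix `< t+1` from a year `i₁ ≥ i₀` on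
    have conclude : ∀ i₁, i₀ ≤ i₁ → (∀ i, i₁ ≤ i → R.inv i t = R.inv i₁ t) →
        ∃ i₀', ∀ i, i₀' ≤ i → ∀ j, j < t + 1 → R.inv i j = R.inv i₀' j := by
      intro i₁ hi₁ ht
      refine ⟨i₁, fun i hi j hj => ?_⟩
      rcases Nat.lt_succ_iff_lt_or_eq.mp hj with hj | rfl
      · rw [h₀ i (le_trans hi₁ hi) j hj, h₀ i₁ hi₁ j hj]
      · exact ht i hi
    by_cases hbot : ∃ i₁, i₀ ≤ i₁ ∧ R.inv i₁ t = ⊥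
    · -- the weaving eventually stops before stage `t`: then it stays so
      obtain ⟨i₁, hi₁, hb⟩ := hbot
      exact conclude i₁ hi₁ fun i hi =>
        by rw [hb]; exact WithBot.le_bot_iff.mp (hb ▸ hchain i₁ i hi₁ hi)
    · -- the `t`-th unit exists from year `i₀` on
      push Not at hbot
      let u : ℕ → IFPUnit S M := fun i =>
        (R.inv (max i i₀) t).unbot (hbot (max i i₀) (le_max_right _ _))
      have hu : ∀ i, i₀ ≤ i → R.inv i t = ↑(u i) := by
        intro i hi
        simp only [u, max_eq_left hi, WithBot.coe_unbot]
      have hule : ∀ i, i₀ ≤ i → u (i + 1) ≤ u i := by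
        intro i hi
        have := hanti i hi
        rw [hu (i + 1) (by omega), hu i hi] at this
        exact WithBot.coe_le_coe.mp this
      -- σ stabilizes (DCC on `S`)
      obtain ⟨i₁, hi₁, hσ⟩ := eventually_const_of_antitone (fun i => (u i).σ) i₀ Set.univ
        (Set.isWF_univ_iff.mpr inferInstance) (fun i hi => IFPUnit.σ_le_of_le (hule i hi))
        (fun _ _ => Set.mem_univ _)
      -- μ̃ stabilizes (bounded denominators)
      obtain ⟨W, hW, hWmem⟩ := R.boundedDenominators t i₁ (fun i hi => ⟨fun j hj => by
          rw [h₀ i (le_trans hi₁ hi) j hj, h₀ i₁ hi₁ j hj], by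
          rw [hu i (le_trans hi₁ hi), hu i₁ hi₁, WithBot.map_coe, WithBot.map_coe, hσ i hi]⟩)
      obtain ⟨i₂, hi₂, hμ⟩ := eventually_const_of_antitone (fun i => (u i).μ) i₁ W hW
        (fun i hi => IFPUnit.μ_le_of_le (hule i (le_trans hi₁ hi))
          (by rw [hσ (i + 1) (by omega), hσ i hi]))
        (fun i hi => hWmem i hi (u i) (hu i (le_trans hi₁ hi)))
      -- s stabilizes (ℕ)
      obtain ⟨i₃, hi₃, hs⟩ := eventually_const_of_antitone (fun i => (u i).s) i₂ Set.univ
        (Set.isWF_univ_iff.mpr inferInstance)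
        (fun i hi => IFPUnit.s_le_of_le (hule i (le_trans (le_trans hi₁ hi₂) hi))
          (by rw [hσ (i + 1) (by omega), hσ i (le_trans hi₂ hi)])
          (by rw [hμ (i + 1) (by omega), hμ i hi]))
        (fun _ _ => Set.mem_univ _)
      have h03 : i₀ ≤ i₃ := le_trans hi₁ (le_trans hi₂ hi₃)
      refine conclude i₃ h03 fun i hi => ?_
      rw [hu i (le_trans h03 hi), hu i₃ h03]
      congr 1
      exact IFPUnit.ext
        (by simpa using (hσ i (le_trans hi₂ (le_trans hi₃ hi))).trans (hσ i₃ (le_trans hi₂ hi₃)).symm)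
        (by simpa using (hμ i (le_trans hi₃ hi)).trans (hμ i₃ hi₃).symm)
        (by simpa using hs i hi)

/-- **Termination of the weaving in the vertical direction, bookkeeping part**: the strand is
eventually constant. The two-step `σ`-drop is what bounds the LENGTH of the stabilized strands — a
lexicographic order on finite sequences over a well-order is not well-founded along sequences of
growing length, and this is the only way all prefixes can stabilize without the strand stabilizing.
[cite: KawanoueMatsuki2016, §4.3] -/
theorem eventually_constant : ∃ i₀, ∀ i, i₀ ≤ i → R.inv i = R.inv i₀ := by
  choose N hN using R.prefix_stable
  by_cases hfin : ∃ t i₁, ∀ i, i₁ ≤ i → R.inv i t = ⊥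
  · -- the stabilized strand has length `≤ t`: it is the stabilized prefix
    obtain ⟨t, i₁, hb⟩ := hfin
    refine ⟨max i₁ (N t), fun i hi => funext fun j => ?_⟩
    by_cases hj : j < t
    · rw [hN t i (le_trans (le_max_right _ _) hi) j hj, hN t (max i₁ (N t)) (le_max_right _ _) j hj]
    · push Not at hj
      rw [R.eq_bot_of_le (hb i (le_trans (le_max_left _ _) hi)) hj,
        R.eq_bot_of_le (hb _ (le_max_left _ _)) hj]
  · -- otherwise every stage is eventually occupied: build the infinite `σ`-descent
    exfalso
    push Not at hfin
    -- unit `t` exists at every year `≥ N (t+1)`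
    have hocc : ∀ t i, N (t + 1) ≤ i → R.inv i t ≠ ⊥ := by
      intro t i hi
      obtain ⟨i', hi', hne⟩ := hfin t (N (t + 1))
      rw [hN (t + 1) i hi t (Nat.lt_succ_self t), ← hN (t + 1) i' hi' t (Nat.lt_succ_self t)]
      exact hne
    -- the year from which on the units `≤ t+2` are frozen, and the frozen units
    let K : ℕ → ℕ := fun t => max (N (t + 3)) (max (N (t + 1)) (max (N (t + 2)) (N (t + 3))))
    have hKN : ∀ t j, j ≤ t + 2 → ∀ i, K t ≤ i → R.inv i j = R.inv (K t) j := by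
      intro t j hj i hi
      have h1 : N (t + 3) ≤ K t := le_max_left _ _
      rw [hN (t + 3) i (le_trans h1 hi) j (by omega), hN (t + 3) (K t) h1 j (by omega)]
    have hK1 : ∀ t, N (t + 1) ≤ K t := fun t =>
      le_trans (le_max_left _ _) (le_max_right _ _)
    have hK2 : ∀ t, N (t + 2) ≤ K t := fun t =>
      le_trans (le_trans (le_max_left _ _) (le_max_right _ _)) (le_max_right _ _)
    have hK3 : ∀ t, N (t + 3) ≤ K t := fun t => le_max_left _ _
    have hne0 : ∀ t, R.inv (K t) t ≠ ⊥ := fun t => hocc t (K t) (hK1 t)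
    have hne1 : ∀ t, R.inv (K t) (t + 1) ≠ ⊥ := fun t => hocc (t + 1) (K t) (hK2 t)
    have hne2 : ∀ t, R.inv (K t) (t + 2) ≠ ⊥ := fun t => hocc (t + 2) (K t) (hK3 t)
    let w₀ : ℕ → IFPUnit S M := fun t => (R.inv (K t) t).unbot (hne0 t)
    let w₁ : ℕ → IFPUnit S M := fun t => (R.inv (K t) (t + 1)).unbot (hne1 t)
    let w₂ : ℕ → IFPUnit S M := fun t => (R.inv (K t) (t + 2)).unbot (hne2 t)
    have hw₀ : ∀ t, R.inv (K t) t = ↑(w₀ t) := fun t => by simp [w₀]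
    have hw₁ : ∀ t, R.inv (K t) (t + 1) = ↑(w₁ t) := fun t => by simp [w₁]
    have hw₂ : ∀ t, R.inv (K t) (t + 2) = ↑(w₂ t) := fun t => by simp [w₂]
    -- the frozen unit `t+1` seen from `t` and from `t+1` is the same (two constant tails)
    have h₁₀ : ∀ t, w₁ t = w₀ (t + 1) := by
      intro t
      have e := tail_value_unique (fun i => R.inv i (t + 1))
        (p := K t) (q := K (t + 1)) (fun i hi => hKN t (t + 1) (by omega) i hi)
        (fun i hi => hKN (t + 1) (t + 1) (by omega) i hi)
      have : (↑(w₁ t) : WithBot (IFPUnit S M)) = ↑(w₀ (t + 1)) := by rw [← hw₁, ← hw₀]; exact e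
      exact WithBot.coe_inj.mp this
    have h₂₀ : ∀ t, w₂ t = w₀ (t + 2) := by
      intro t
      have e := tail_value_unique (fun i => R.inv i (t + 2))
        (p := K t) (q := K (t + 2)) (fun i hi => hKN t (t + 2) (by omega) i hi)
        (fun i hi => hKN (t + 2) (t + 2) (by omega) i hi)
      have : (↑(w₂ t) : WithBot (IFPUnit S M)) = ↑(w₀ (t + 2)) := by rw [← hw₂, ← hw₀]; exact e
      exact WithBot.coe_inj.mp this
    -- the printed inputs at year `K t`
    have hdrop : ∀ t, (w₀ (t + 2)).σ < (w₀ t).σ := by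
      intro t
      have h21 : (w₂ t).σ ≤ (w₁ t).σ := R.horizontal (K t) (t + 1) _ _ (hw₁ t) (hw₂ t)
      rcases R.twoStepDrop t (K t) (fun i' hi' j hj => hKN t j hj i' hi') _ _ _ (hw₀ t) (hw₁ t)
          (hw₂ t) with h | ⟨h, h'⟩
      · rw [← h₂₀]; exact lt_of_le_of_lt h21 h
      · rw [← h₂₀, ← h]; exact h'
    -- an infinite strictly decreasing sequence in `S`
    have hdesc : ∀ n, (w₀ (2 * (n + 1))).σ < (w₀ (2 * n)).σ := fun n => by
      have := hdrop (2 * n)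
      simpa [Nat.mul_succ] using this
    exact (RelEmbedding.natGT (fun n => (w₀ (2 * n)).σ) hdesc).not_wellFounded wellFounded_lt

/-- **"Therefore, the algorithm terminates after finitely many years."** The printed conclusion of
each year's weaving — "in some year `i'`, the value of the strand strictly decreases" (from the
Nonsingularity Principle in the case `(σ^m, ∞, 0)` and from resolution in the MONOMIAL CASE in the
case `(σ^m, 0, 0)`) — cannot hold at every year of an infinite run. [cite: KawanoueMatsuki2016, §4.3] -/
theorem no_infinite_run
    (strictDecrease : ∀ i, ∃ i', i < i' ∧ toLex (R.inv i') < toLex (R.inv i)) : False := by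
  obtain ⟨i₀, h⟩ := R.eventually_constant
  obtain ⟨i', hi', hlt⟩ := strictDecrease i₀
  rw [h i' (le_of_lt hi')] at hlt
  exact lt_irrefl _ hlt

end IFPRun

/-! ### Sharpness: the two-step `σ`-drop cannot be omitted

The run `growingRun` below — in year `i` the strand has `i + 1` units, all equal to `(0, 0, 0)` except the
last, which is `(0, 0, 1)` — satisfies `wellFormed`, `nonIncreasing` (indeed it strictly decreases every
year: `(0,0,1) > (0,0,0)(0,0,1) > (0,0,0)(0,0,0)(0,0,1) > ⋯`), `boundedDenominators` (all `μ̃ = 0`) and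
`horizontal` (all `σ = 0`), every prefix stabilizes, and yet the strand is NOT eventually constant: its
length grows without bound. So the printed claim "`σ_t > σ_{t+1}` or `σ_t = σ_{t+1} > σ_{t+2}`" is exactly the
ingredient of [KM16] §4.3 that excludes this behaviour; `IFPRun.eventually_constant` is sharp in it.
[folklore] -/

section Sharpness

/-- The unit `(0, 0, 0)`. [folklore] -/
def u₀ : IFPUnit ℕ ℕ := toLex (0, toLex (0, 0))
/-- The unit `(0, 0, 1)`. [folklore] -/
def u₁ : IFPUnit ℕ ℕ := toLex (0, toLex (0, 1))

/-- `(0,0,0) < (0,0,1)` lexicographically. [folklore] -/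
theorem u₀_lt_u₁ : u₀ < u₁ :=
  Prod.Lex.toLex_lt_toLex.mpr (Or.inr ⟨rfl, Prod.Lex.toLex_lt_toLex.mpr (Or.inr ⟨rfl, Nat.zero_lt_one⟩)⟩)

/-- The run with strands `(0,0,0)^i (0,0,1)` of growing length. [folklore] -/
def growingRun : ℕ → Strand ℕ ℕ := fun i j =>
  if j < i then (u₀ : WithBot (IFPUnit ℕ ℕ)) else if j = i then (u₁ : WithBot (IFPUnit ℕ ℕ)) else ⊥

/-- Units before the last are `u₀`. [folklore] -/
theorem growingRun_of_lt {i j : ℕ} (h : j < i) : growingRun i j = ↑u₀ := by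
  simp [growingRun, h]

/-- The last unit of year `i` is `u₁`, at stage `i`. [folklore] -/
theorem growingRun_self (i : ℕ) : growingRun i i = ↑u₁ := by
  simp [growingRun]

/-- No unit after stage `i` in year `i`. [folklore] -/
theorem growingRun_of_gt {i j : ℕ} (h : i < j) : growingRun i j = ⊥ := by
  simp [growingRun, Nat.lt_asymm h, Nat.ne_of_gt h]

/-- Units occurring in `growingRun` are `u₀` or `u₁`. [folklore] -/
theorem growingRun_eq_coe {i j : ℕ} {u : IFPUnit ℕ ℕ} (h : growingRun i j = ↑u) : u = u₀ ∨ u = u₁ := by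
  rcases lt_trichotomy j i with hji | rfl | hij
  · rw [growingRun_of_lt hji] at h; exact Or.inl (WithBot.coe_inj.mp h).symm
  · rw [growingRun_self] at h; exact Or.inr (WithBot.coe_inj.mp h).symm
  · rw [growingRun_of_gt hij] at h; exact absurd h.symm (WithBot.coe_ne_bot)

/-- `growingRun` strictly decreases every year (lexicographically). [folklore] -/
theorem growingRun_lt (i : ℕ) : toLex (growingRun (i + 1)) < toLex (growingRun i) := by
  refine ⟨i, fun j hj => ?_, ?_⟩
  · show growingRun (i + 1) j = growingRun i j
    rw [growingRun_of_lt hj, growingRun_of_lt (Nat.lt_succ_of_lt hj)]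
  · show growingRun (i + 1) i < growingRun i i
    rw [growingRun_self, growingRun_of_lt (Nat.lt_succ_self i)]
    exact WithBot.coe_lt_coe.mpr u₀_lt_u₁

/-- `growingRun` with the four hypotheses of `IFPRun` other than `twoStepDrop`. [folklore] -/
theorem growingRun_hypotheses :
    (∀ i j, growingRun i j = ⊥ → growingRun i (j + 1) = ⊥) ∧
    (∀ i, toLex (growingRun (i + 1)) ≤ toLex (growingRun i)) ∧
    (∀ t i₀, (∀ i, i₀ ≤ i → (∀ j, j < t → growingRun i j = growingRun i₀ j) ∧
        (growingRun i t).map IFPUnit.σ = (growingRun i₀ t).map IFPUnit.σ) →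
      ∃ W : Set ℕ, W.IsWF ∧ ∀ i, i₀ ≤ i → ∀ u : IFPUnit ℕ ℕ, growingRun i t = ↑u → u.μ ∈ W) ∧
    (∀ i j (u v : IFPUnit ℕ ℕ), growingRun i j = ↑u → growingRun i (j + 1) = ↑v → v.σ ≤ u.σ) := by
  refine ⟨fun i j h => ?_, fun i => le_of_lt (growingRun_lt i), fun t i₀ _ => ?_, fun i j u v hu hv => ?_⟩
  · rcases lt_trichotomy j i with hji | rfl | hij
    · rw [growingRun_of_lt hji] at h; exact absurd h WithBot.coe_ne_bot
    · rw [growingRun_self] at h; exact absurd h WithBot.coe_ne_bot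
    · exact growingRun_of_gt (Nat.lt_succ_of_lt hij)
  · refine ⟨Set.univ, Set.isWF_univ_iff.mpr inferInstance, fun _ _ _ _ => Set.mem_univ _⟩
  · rcases growingRun_eq_coe hu with rfl | rfl <;> rcases growingRun_eq_coe hv with rfl | rfl <;>
      exact le_rfl

/-- … and its strand is not eventually constant. [folklore] -/
theorem growingRun_not_eventually_constant : ¬∃ i₀, ∀ i, i₀ ≤ i → growingRun i = growingRun i₀ := by
  rintro ⟨i₀, h⟩
  have e := congrFun (h (i₀ + 1) (Nat.le_succ i₀)) (i₀ + 1)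
  rw [growingRun_self, growingRun_of_gt (Nat.lt_succ_self i₀)] at e
  exact WithBot.coe_ne_bot e

end Sharpness

end Literature.AlgebraicGeometry.KawanoueMatsuki2016
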